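import Summits.QuantumFields.BalabanUV.Beta.GAN24.DerivativeRateTransferJensenMassFreeHub
import Summits.QuantumFields.BalabanUV.Beta.GAN24.DerivativeRateTransferJensenMassFreePolarFactor
import Summits.QuantumFields.BalabanUV.Beta.GAN24.DerivativeRateTransferJensenLattice

/-!
# `BalabanUV.Beta.GAN24.DerivativeRateTransferJensenMassFreeRectangle` — binder row G-an2-4 ∕ (CONV-C), route R6 «VALUES, NOT DERIVATIVES», PART 60:
# LATTICE STOKES FOR THE POLAR PAIR's LOOPS — on PART 24's block-lattice encoding with COMB block transporters (`W y (z + e_μ) = W y z·R((y,z),μ)`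
# whenever all coordinates of `z` after `μ` vanish: Bałaban's taxi contour for one axis order) the loop of a canonical comb step is a conjugate of the
# transposed `1 × L` RECTANGLE between the two straight chains, a ladder of `L` plaquettes, so its defect is `≤ L·p̂` (PART 27 `defect_ladder`); with
# PART 59 the closed-loop letter of PARTs 57 ∕ 58 holds ON EVERY BLOCK with `D = 2d(L−1)·L·p̂`, and PART 58's polar links exist on the lattice
# (unit b2b-balaban-gan24-p3, gen 44; v1)

NOT IN PRINT; OUR PROOF (for the ROUTE; [folklore] — chain arithmetic with carry on `(Fin d → ZMod M) × (Fin d → Fin L)` (PART 24), the partial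
transports as `List.ofFn` products and the abstract rectangle of PART 59 §3 (PART 27's ladder lemma and PART 25's defect algebra BY NAME), PART 59's comb
induction, PART 58's polar existence).
HONEST FRAMING (cell contract, verbatim): «discharging `BetaPertH` makes Bałaban's UV stability UNCONDITIONAL — a real constructive-QFT result; it is NOT
the continuum limit and NOT the Clay problem.»  HONEST DEPENDENCY (verbatim): «continuum YM on T⁴ ⇐ BetaPertH ∧ nine spine estimates (0/9 proved);
BetaPertH ⇐ (D1) ∧ (D4) ∧ CAP+tail; G-an2-4 gates asym, D1 and NE2/3/4.»

WHY THIS FILE.  The pricing desk's display for the polar pair's (STAB)^{cov} (PRICING-GAN24 v3.53 R6 (b)) reads «κ := 2D: the p̂-constant = lattice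
Stokes on the pair's CLOSED loops of length ≤ 4·depth + 2ℓ [tree]; the plaquette count stays LENS ITEM 12 (C), PAPER».  THIS FILE types the count
on PART 24's encoding.  DATA: fine bond transporters `R (x, μ)` (orthogonal) with the PLAQUETTE LETTER
`|(R(p,μ′)·R(p +_{μ′} 1, μ)·R(p +_μ 1, μ′)ᵀ·R(p,μ)ᵀ − 1)w|² ≤ p̂²|w|²` for `μ′ ≠ μ` (`+_μ 1` = PART 24's next site with carry); block transporters
`W y x` (orthogonal) obeying the COMB RECURSION `W y (y, z[μ ↦ z_μ + 1]) = W y (y, z)·R((y,z), μ)` whenever `z_ν = 0` for all `ν > μ` (the taxi contour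
from the block's root corner filling direction `0` first, then `1`, …; the root frames `W y (y,0)` are free); the straight chains `T` of PART 24.  RESULTS:
(§1) chain arithmetic: the chain from `z + e_μ` is the chain from `z` SHIFTED by `e_μ` (`μ ≠ μ′`, no carry in direction `μ`) resp. ADVANCED by one
step (`μ = μ′`); (§2) **`canonicalStep_loopDefect`**: for a canonical step `z → z⁺ = z + e_μ` in block `y = src′e′`
the loop `τ_zᵀτ_{z⁺}` (`τ_z = W(y,z)·T_z·W(y′,z)ᵀ`) equals `W(y′,z)·T_zᵀ·Λᵀ·T_z·W(y′,z)ᵀ` with `Λ = T_z·R((y′,z),μ)·T_{z⁺}ᵀ·R((y,z),μ)ᵀ` the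
LADDER of PART 27 (bottom = chain of `z`, top = chain of `z⁺`, rungs = the `μ`-bonds at the chain vertices; its `i`-th plaquette is the lattice
plaquette at the `i`-th chain vertex in the plane `(μ′, μ)`, or the trivial word when `μ = μ′`), hence `|(τ_zᵀτ_{z⁺} − 1)w|² ≤ (L·p̂)²|w|²`;
(§3) **`loopDefect_lattice`**: by PART 59 `loopDefect_comb`, for all sites `x, x′` of the block `src′e′`:
`|(τ_xᵀτ_{x′} − 1)w|² ≤ (2d(L−1)·L·p̂)²|w|²` — PART 57 ∕ 58's closed-loop letter ON THE SUPPORT OF THE BLOCK WEIGHTS with `D = 2d(L−1)Lp̂`;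
**`exists_polarLink_lattice`**: PART 58 `exists_polarLink` on the lattice — for `2d(L−1)Lp̂ < 1` the polar coarse links of the comb-averaged field
EXIST (orthogonal, `hsym`, `hPpsd`).

HONEST SCOPE.  The closed-loop letter is delivered for the sites OF THE BLOCK (`x.1 = x′.1 = src′e′`), which is all the q-weighted sums of PARTs 47–57
see; PART 53 ∕ 57's ENDs as typed quantify their pointwise letters `hN` ∕ `hloop` over ALL fine sites (off-block values of `W y ·` are unconstrained
data, and on the torus no choice makes those loops small) — the support-local variants of those ENDs are a separate file; nothing here changes them.
One axis order (no average over permutations as in [CMP 109] (0.11)); `p̂` is a letter (small-field input), not derived.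

WHAT THIS FILE PROVES (0 sorry, 0 `def`, nothing cited): §1 `nxt_of_lt`, `chain_shift`, `chain_advance`; §2 **`canonicalStep_loopDefect`**; §3
**`loopDefect_lattice`**, **`exists_polarLink_lattice`**.
WHAT IT DOES NOT DO: re-type PART 53 ∕ 57's ENDs support-locally, bound `p̂`, treat the permutation-averaged contours or Bałaban's `Ū`, or claim (CONS) ∕
exact (STAB).  SUPPLIER work on route R6 (rank 2, REDUCTION, no seat); no consumer of record; NEVER «G-an2-4 closed»; NOT (CONV-C), NOT D1, NOT
`BetaPertH`, NOT continuum, NOT Clay.  Records: `HOME/b2b-balaban-gan24-p3/WOODBURY-FIBRE.md` v14.4. -/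

noncomputable section

open Matrix Finset Function

namespace Summit.QuantumFields.BalabanUV.Beta.GAN24.DerivativeRateTransferJensenMassFreeRectangle

open Summit.QuantumFields.BalabanUV.Beta.GAN24.DerivativeRateTransferJensenChain
open Summit.QuantumFields.BalabanUV.Beta.GAN24.DerivativeRateTransferJensenHolonomy
open Summit.QuantumFields.BalabanUV.Beta.GAN24.DerivativeRateTransferJensenLadder
open Summit.QuantumFields.BalabanUV.Beta.GAN24.DerivativeRateTransferJensenLattice
open Summit.QuantumFields.BalabanUV.Beta.GAN24.DerivativeRateTransferJensenMassFreeHub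
open Summit.QuantumFields.BalabanUV.Beta.GAN24.DerivativeRateTransferJensenMassFreePolarFactor

variable {d L M : ℕ}

/-! ## §1 Chain arithmetic: shifted and advanced chains -/

section Chains

/-- no carry below the top: `a + 1 < L ⟹ (a + 1) ∕ L = 0`, `(a + 1) % L = a + 1`. [folklore] -/
theorem nxt_of_lt {a : ℕ} (h : a + 1 < L) : (a + 1) / L = 0 ∧ (a + 1) % L = a + 1 :=
  ⟨Nat.div_eq_of_lt h, Nat.mod_eq_of_lt h⟩

/-- **THE SHIFTED CHAIN** (`μ ≠ μ′`): the next site in direction `μ` (with carry) after the `i`-th vertex of the `μ′`-chain from `x` is the `i`-th vertex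
of the `μ′`-chain from `x + e_μ` (no carry in direction `μ`: `x.2 μ + 1 < L`). [folklore] -/
theorem chain_shift (hL : 0 < L) {μ μ' : Fin d} (hne : μ' ≠ μ) (x : (Fin d → ZMod M) × (Fin d → Fin L)) (h : (x.2 μ : ℕ) + 1 < L) (i : ℕ) :
    (let p : (Fin d → ZMod M) × (Fin d → Fin L) :=
        (x.1 + (((x.2 μ' : ℕ) + i) / L) • (Pi.single μ' (1 : ZMod M)), update x.2 μ' ⟨((x.2 μ' : ℕ) + i) % L, Nat.mod_lt _ hL⟩);
      ((p.1 + (((p.2 μ : ℕ) + 1) / L) • (Pi.single μ (1 : ZMod M)), update p.2 μ ⟨((p.2 μ : ℕ) + 1) % L, Nat.mod_lt _ hL⟩) :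
        (Fin d → ZMod M) × (Fin d → Fin L))) =
      ((x.1 + ((((update x.2 μ ⟨(x.2 μ : ℕ) + 1, h⟩ : Fin d → Fin L) μ' : ℕ) + i) / L) • (Pi.single μ' (1 : ZMod M)),
        update (update x.2 μ ⟨(x.2 μ : ℕ) + 1, h⟩) μ'
          ⟨(((update x.2 μ ⟨(x.2 μ : ℕ) + 1, h⟩ : Fin d → Fin L) μ' : ℕ) + i) % L, Nat.mod_lt _ hL⟩) :
        (Fin d → ZMod M) × (Fin d → Fin L)) := by
  dsimp only
  have hμ : ((update x.2 μ' (⟨((x.2 μ' : ℕ) + i) % L, Nat.mod_lt _ hL⟩ : Fin L) μ : Fin L) : ℕ) = (x.2 μ : ℕ) := by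
    rw [update_of_ne hne.symm]
  have hμ' : ((update x.2 μ (⟨(x.2 μ : ℕ) + 1, h⟩ : Fin L) μ' : Fin L) : ℕ) = (x.2 μ' : ℕ) := by
    rw [update_of_ne hne]
  have hc : (((update x.2 μ' (⟨((x.2 μ' : ℕ) + i) % L, Nat.mod_lt _ hL⟩ : Fin L) μ : Fin L) : ℕ) + 1) / L = 0 := by
    rw [hμ]; exact (nxt_of_lt h).1
  have hv : (⟨(((update x.2 μ' (⟨((x.2 μ' : ℕ) + i) % L, Nat.mod_lt _ hL⟩ : Fin L) μ : Fin L) : ℕ) + 1) % L, Nat.mod_lt _ hL⟩ : Fin L) =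
      ⟨(x.2 μ : ℕ) + 1, h⟩ := Fin.ext (by rw [Fin.val_mk, Fin.val_mk, hμ]; exact (nxt_of_lt h).2)
  have hc' : (((update x.2 μ (⟨(x.2 μ : ℕ) + 1, h⟩ : Fin L) μ' : Fin L) : ℕ) + i) / L = ((x.2 μ' : ℕ) + i) / L := by rw [hμ']
  have hm' : (⟨(((update x.2 μ (⟨(x.2 μ : ℕ) + 1, h⟩ : Fin L) μ' : Fin L) : ℕ) + i) % L, Nat.mod_lt _ hL⟩ : Fin L) =
      ⟨((x.2 μ' : ℕ) + i) % L, Nat.mod_lt _ hL⟩ := Fin.ext (by rw [Fin.val_mk, Fin.val_mk, hμ'])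
  simp only [Prod.mk.injEq]
  refine ⟨?_, ?_⟩
  · rw [hc, zero_smul, add_zero, hc']
  · rw [hv, hm', update_comm hne]

/-- **THE ADVANCED CHAIN** (`μ = μ′`): the `i`-th vertex of the `μ`-chain from `x + e_μ` is the `(i+1)`-th vertex of the `μ`-chain from `x`. [folklore] -/
theorem chain_advance (hL : 0 < L) (μ : Fin d) (x : (Fin d → ZMod M) × (Fin d → Fin L)) (h : (x.2 μ : ℕ) + 1 < L) (i : ℕ) :
    ((x.1 + ((((update x.2 μ ⟨(x.2 μ : ℕ) + 1, h⟩ : Fin d → Fin L) μ : ℕ) + i) / L) • (Pi.single μ (1 : ZMod M)),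
        update (update x.2 μ ⟨(x.2 μ : ℕ) + 1, h⟩) μ
          ⟨(((update x.2 μ ⟨(x.2 μ : ℕ) + 1, h⟩ : Fin d → Fin L) μ : ℕ) + i) % L, Nat.mod_lt _ hL⟩) : (Fin d → ZMod M) × (Fin d → Fin L)) =
      (x.1 + (((x.2 μ : ℕ) + (i + 1)) / L) • (Pi.single μ (1 : ZMod M)), update x.2 μ ⟨((x.2 μ : ℕ) + (i + 1)) % L, Nat.mod_lt _ hL⟩) := by
  have hv : ((update x.2 μ (⟨(x.2 μ : ℕ) + 1, h⟩ : Fin L) μ : Fin L) : ℕ) = (x.2 μ : ℕ) + 1 := by rw [update_self]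
  have ha : (x.2 μ : ℕ) + 1 + i = (x.2 μ : ℕ) + (i + 1) := by ring
  rw [hv, update_idem, ha]

end Chains

/-! ## §2 A canonical comb step's loop is a conjugated transposed rectangle: defect `≤ L·p̂` -/

section Step

variable {o : Type*} [Fintype o] [DecidableEq o]

/-- **`canonicalStep_loopDefect` — A CANONICAL COMB STEP's LOOP IS WITHIN `L·p̂`** [our proof].  PART 24's encoding (blocks `Fin d → ZMod M`, positions
`Fin d → Fin L`, `L > 0`); orthogonal fine transporters `R` with the plaquette letter `p̂ ≥ 0` (for `μ′ ≠ μ`); orthogonal block transporters `W` with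
the COMB RECURSION; the straight chains `T` of PART 24 (coarse bond `e′ = (y, μ′)`).  For every position `z` and direction `μ` with `z_μ + 1 < L` and
`z_ν = 0` for all `ν > μ`, writing `τ_x = W(y,x)·T(e′,x,L)·W(y + e_{μ′}, x + L e_{μ′})ᵀ`:
`|(τ_{(y,z)}ᵀ·τ_{(y,z + e_μ)} − 1)w|² ≤ (L·p̂)²·|w|²`. -/
theorem canonicalStep_loopDefect [NeZero M] (hL : 0 < L)
    {R : ((Fin d → ZMod M) × (Fin d → Fin L)) × Fin d → Matrix o o ℝ} (hR : ∀ e, (R e)ᵀ * R e = 1) {phat : ℝ} (hphat : 0 ≤ phat)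
    (hplaq : ∀ (p : (Fin d → ZMod M) × (Fin d → Fin L)) (μ' μ : Fin d), μ' ≠ μ → ∀ w : o → ℝ,
      ((R (p, μ') *
              R (((p.1 + (((p.2 μ' : ℕ) + 1) / L) • (Pi.single μ' (1 : ZMod M)), update p.2 μ' ⟨((p.2 μ' : ℕ) + 1) % L, Nat.mod_lt _ hL⟩) :
                (Fin d → ZMod M) × (Fin d → Fin L)), μ) *
            (R (((p.1 + (((p.2 μ : ℕ) + 1) / L) • (Pi.single μ (1 : ZMod M)), update p.2 μ ⟨((p.2 μ : ℕ) + 1) % L, Nat.mod_lt _ hL⟩) :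
                (Fin d → ZMod M) × (Fin d → Fin L)), μ'))ᵀ *
          (R (p, μ))ᵀ - 1) *ᵥ w) ⬝ᵥ
        ((R (p, μ') *
              R (((p.1 + (((p.2 μ' : ℕ) + 1) / L) • (Pi.single μ' (1 : ZMod M)), update p.2 μ' ⟨((p.2 μ' : ℕ) + 1) % L, Nat.mod_lt _ hL⟩) :
                (Fin d → ZMod M) × (Fin d → Fin L)), μ) *
            (R (((p.1 + (((p.2 μ : ℕ) + 1) / L) • (Pi.single μ (1 : ZMod M)), update p.2 μ ⟨((p.2 μ : ℕ) + 1) % L, Nat.mod_lt _ hL⟩) :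
                (Fin d → ZMod M) × (Fin d → Fin L)), μ'))ᵀ *
          (R (p, μ))ᵀ - 1) *ᵥ w) ≤ phat ^ 2 * (w ⬝ᵥ w))
    {W : (Fin d → ZMod M) → (Fin d → ZMod M) × (Fin d → Fin L) → Matrix o o ℝ} (hW : ∀ y x, (W y x)ᵀ * W y x = 1)
    (hWstep : ∀ (y : Fin d → ZMod M) (z : Fin d → Fin L) (μ : Fin d) (h : (z μ : ℕ) + 1 < L), (∀ ν, μ < ν → (z ν : ℕ) = 0) →
      W y (y, update z μ ⟨(z μ : ℕ) + 1, h⟩) = W y (y, z) * R ((y, z), μ))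
    {T : (Fin d → ZMod M) × Fin d → (Fin d → ZMod M) × (Fin d → Fin L) → ℕ → Matrix o o ℝ} (hT0 : ∀ e' x, T e' x 0 = 1)
    (hT : ∀ e' x i, i < L → T e' x (i + 1) = T e' x i *
      R (((x.1 + (((x.2 e'.2 : ℕ) + i) / L) • (Pi.single e'.2 (1 : ZMod M)),
            update x.2 e'.2 ⟨((x.2 e'.2 : ℕ) + i) % L, Nat.mod_lt _ hL⟩) : (Fin d → ZMod M) × (Fin d → Fin L)), e'.2))
    (e' : (Fin d → ZMod M) × Fin d) (z : Fin d → Fin L) (μ : Fin d) (h : (z μ : ℕ) + 1 < L) (hlater : ∀ ν, μ < ν → (z ν : ℕ) = 0)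
    (w : o → ℝ) :
    (((W e'.1 (e'.1, z) * T e' (e'.1, z) L * (W (e'.1 + Pi.single e'.2 1) (e'.1 + Pi.single e'.2 1, z))ᵀ)ᵀ *
            (W e'.1 (e'.1, update z μ ⟨(z μ : ℕ) + 1, h⟩) * T e' (e'.1, update z μ ⟨(z μ : ℕ) + 1, h⟩) L *
              (W (e'.1 + Pi.single e'.2 1) (e'.1 + Pi.single e'.2 1, update z μ ⟨(z μ : ℕ) + 1, h⟩))ᵀ) - 1) *ᵥ w) ⬝ᵥ
        (((W e'.1 (e'.1, z) * T e' (e'.1, z) L * (W (e'.1 + Pi.single e'.2 1) (e'.1 + Pi.single e'.2 1, z))ᵀ)ᵀ *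
            (W e'.1 (e'.1, update z μ ⟨(z μ : ℕ) + 1, h⟩) * T e' (e'.1, update z μ ⟨(z μ : ℕ) + 1, h⟩) L *
              (W (e'.1 + Pi.single e'.2 1) (e'.1 + Pi.single e'.2 1, update z μ ⟨(z μ : ℕ) + 1, h⟩))ᵀ) - 1) *ᵥ w) ≤
      (L * phat) ^ 2 * (w ⬝ᵥ w) := by
  -- the chain endpoints in block `e′.1` at position `z`
  have e0 : ((e'.1 + (((z e'.2 : ℕ) + 0) / L) • (Pi.single e'.2 (1 : ZMod M)), update z e'.2 ⟨((z e'.2 : ℕ) + 0) % L, Nat.mod_lt _ hL⟩) :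
      (Fin d → ZMod M) × (Fin d → Fin L)) = (e'.1, z) := chain_zero hL e'.2 (e'.1, z)
  have eL : ((e'.1 + (((z e'.2 : ℕ) + L) / L) • (Pi.single e'.2 (1 : ZMod M)), update z e'.2 ⟨((z e'.2 : ℕ) + L) % L, Nat.mod_lt _ hL⟩) :
      (Fin d → ZMod M) × (Fin d → Fin L)) = (e'.1 + Pi.single e'.2 1, z) := chain_end hL e'.2 (e'.1, z)
  -- the comb recursion in both blocks, through the end rungs
  have hWx : W e'.1 (e'.1, update z μ ⟨(z μ : ℕ) + 1, h⟩) = W e'.1 (e'.1, z) *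
      R (((e'.1 + (((z e'.2 : ℕ) + 0) / L) • (Pi.single e'.2 (1 : ZMod M)), update z e'.2 ⟨((z e'.2 : ℕ) + 0) % L, Nat.mod_lt _ hL⟩) :
        (Fin d → ZMod M) × (Fin d → Fin L)), μ) := by
    rw [e0]; exact hWstep e'.1 z μ h hlater
  have hWx' : W (e'.1 + Pi.single e'.2 1) (e'.1 + Pi.single e'.2 1, update z μ ⟨(z μ : ℕ) + 1, h⟩) =
      W (e'.1 + Pi.single e'.2 1) (e'.1 + Pi.single e'.2 1, z) *
        R (((e'.1 + (((z e'.2 : ℕ) + L) / L) • (Pi.single e'.2 (1 : ZMod M)), update z e'.2 ⟨((z e'.2 : ℕ) + L) % L, Nat.mod_lt _ hL⟩) :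
          (Fin d → ZMod M) × (Fin d → Fin L)), μ) := by
    rw [eL]; exact hWstep (e'.1 + Pi.single e'.2 1) z μ h hlater
  -- the plaquettes between the chain of `z` and the chain of `z + e_μ`
  have hpl : ∀ i, i < L → ∀ w : o → ℝ,
      ((R (((e'.1 + (((z e'.2 : ℕ) + i) / L) • (Pi.single e'.2 (1 : ZMod M)), update z e'.2 ⟨((z e'.2 : ℕ) + i) % L, Nat.mod_lt _ hL⟩) :
              (Fin d → ZMod M) × (Fin d → Fin L)), e'.2) *
            R (((e'.1 + (((z e'.2 : ℕ) + (i + 1)) / L) • (Pi.single e'.2 (1 : ZMod M)),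
                update z e'.2 ⟨((z e'.2 : ℕ) + (i + 1)) % L, Nat.mod_lt _ hL⟩) : (Fin d → ZMod M) × (Fin d → Fin L)), μ) *
            (R (((e'.1 + ((((update z μ ⟨(z μ : ℕ) + 1, h⟩ : Fin d → Fin L) e'.2 : ℕ) + i) / L) • (Pi.single e'.2 (1 : ZMod M)),
                update (update z μ ⟨(z μ : ℕ) + 1, h⟩) e'.2
                  ⟨(((update z μ ⟨(z μ : ℕ) + 1, h⟩ : Fin d → Fin L) e'.2 : ℕ) + i) % L, Nat.mod_lt _ hL⟩) :
                (Fin d → ZMod M) × (Fin d → Fin L)), e'.2))ᵀ *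
            (R (((e'.1 + (((z e'.2 : ℕ) + i) / L) • (Pi.single e'.2 (1 : ZMod M)), update z e'.2 ⟨((z e'.2 : ℕ) + i) % L, Nat.mod_lt _ hL⟩) :
              (Fin d → ZMod M) × (Fin d → Fin L)), μ))ᵀ - 1) *ᵥ w) ⬝ᵥ
        ((R (((e'.1 + (((z e'.2 : ℕ) + i) / L) • (Pi.single e'.2 (1 : ZMod M)), update z e'.2 ⟨((z e'.2 : ℕ) + i) % L, Nat.mod_lt _ hL⟩) :
              (Fin d → ZMod M) × (Fin d → Fin L)), e'.2) *
            R (((e'.1 + (((z e'.2 : ℕ) + (i + 1)) / L) • (Pi.single e'.2 (1 : ZMod M)),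
                update z e'.2 ⟨((z e'.2 : ℕ) + (i + 1)) % L, Nat.mod_lt _ hL⟩) : (Fin d → ZMod M) × (Fin d → Fin L)), μ) *
            (R (((e'.1 + ((((update z μ ⟨(z μ : ℕ) + 1, h⟩ : Fin d → Fin L) e'.2 : ℕ) + i) / L) • (Pi.single e'.2 (1 : ZMod M)),
                update (update z μ ⟨(z μ : ℕ) + 1, h⟩) e'.2
                  ⟨(((update z μ ⟨(z μ : ℕ) + 1, h⟩ : Fin d → Fin L) e'.2 : ℕ) + i) % L, Nat.mod_lt _ hL⟩) :
                (Fin d → ZMod M) × (Fin d → Fin L)), e'.2))ᵀ *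
            (R (((e'.1 + (((z e'.2 : ℕ) + i) / L) • (Pi.single e'.2 (1 : ZMod M)), update z e'.2 ⟨((z e'.2 : ℕ) + i) % L, Nat.mod_lt _ hL⟩) :
              (Fin d → ZMod M) × (Fin d → Fin L)), μ))ᵀ - 1) *ᵥ w) ≤ phat ^ 2 * (w ⬝ᵥ w) := by
    intro i hi w
    by_cases hμμ : e'.2 = μ
    · -- degenerate plaquette: the step is along the chain direction
      subst hμμ
      have eB : ((e'.1 + ((((update z e'.2 ⟨(z e'.2 : ℕ) + 1, h⟩ : Fin d → Fin L) e'.2 : ℕ) + i) / L) • (Pi.single e'.2 (1 : ZMod M)),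
          update (update z e'.2 ⟨(z e'.2 : ℕ) + 1, h⟩) e'.2
            ⟨(((update z e'.2 ⟨(z e'.2 : ℕ) + 1, h⟩ : Fin d → Fin L) e'.2 : ℕ) + i) % L, Nat.mod_lt _ hL⟩) : (Fin d → ZMod M) × (Fin d → Fin L)) =
          (e'.1 + (((z e'.2 : ℕ) + (i + 1)) / L) • (Pi.single e'.2 (1 : ZMod M)), update z e'.2 ⟨((z e'.2 : ℕ) + (i + 1)) % L, Nat.mod_lt _ hL⟩) :=
        chain_advance hL e'.2 (e'.1, z) h i
      rw [eB]
      exact defect_trivialWord (hR _) (hR _) phat w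
    · -- a genuine lattice plaquette at the `i`-th chain vertex in the plane `(e′.2, μ)`
      have hp := hplaq ((e'.1 + (((z e'.2 : ℕ) + i) / L) • (Pi.single e'.2 (1 : ZMod M)),
        update z e'.2 ⟨((z e'.2 : ℕ) + i) % L, Nat.mod_lt _ hL⟩)) e'.2 μ hμμ w
      have e1 := chain_step hL e'.2 (e'.1, z) i
      have e2 := chain_shift (M := M) hL hμμ (e'.1, z) h i
      dsimp only at hp e1 e2
      rw [e1, e2] at hp
      exact hp
  -- the chain recursions in the letters of `stepLoop_defect`
  have hTA : ∀ i, i < L → T e' (e'.1, z) (i + 1) = T e' (e'.1, z) i *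
      R (((e'.1 + (((z e'.2 : ℕ) + i) / L) • (Pi.single e'.2 (1 : ZMod M)),
        update z e'.2 ⟨((z e'.2 : ℕ) + i) % L, Nat.mod_lt _ hL⟩) : (Fin d → ZMod M) × (Fin d → Fin L)), e'.2) :=
    fun i hi => hT e' (e'.1, z) i hi
  have hTB : ∀ i, i < L → T e' (e'.1, update z μ ⟨(z μ : ℕ) + 1, h⟩) (i + 1) = T e' (e'.1, update z μ ⟨(z μ : ℕ) + 1, h⟩) i *
      R (((e'.1 + ((((update z μ ⟨(z μ : ℕ) + 1, h⟩ : Fin d → Fin L) e'.2 : ℕ) + i) / L) • (Pi.single e'.2 (1 : ZMod M)),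
        update (update z μ ⟨(z μ : ℕ) + 1, h⟩) e'.2 ⟨(((update z μ ⟨(z μ : ℕ) + 1, h⟩ : Fin d → Fin L) e'.2 : ℕ) + i) % L, Nat.mod_lt _ hL⟩) :
          (Fin d → ZMod M) × (Fin d → Fin L)), e'.2) :=
    fun i hi => hT e' (e'.1, update z μ ⟨(z μ : ℕ) + 1, h⟩) i hi
  -- the rectangle
  refine stepLoop_defect (ℓ := L)
    (A := fun i => R (((e'.1 + (((z e'.2 : ℕ) + i) / L) • (Pi.single e'.2 (1 : ZMod M)),
      update z e'.2 ⟨((z e'.2 : ℕ) + i) % L, Nat.mod_lt _ hL⟩) : (Fin d → ZMod M) × (Fin d → Fin L)), e'.2))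
    (B := fun i => R (((e'.1 + ((((update z μ ⟨(z μ : ℕ) + 1, h⟩ : Fin d → Fin L) e'.2 : ℕ) + i) / L) • (Pi.single e'.2 (1 : ZMod M)),
      update (update z μ ⟨(z μ : ℕ) + 1, h⟩) e'.2 ⟨(((update z μ ⟨(z μ : ℕ) + 1, h⟩ : Fin d → Fin L) e'.2 : ℕ) + i) % L, Nat.mod_lt _ hL⟩) :
        (Fin d → ZMod M) × (Fin d → Fin L)), e'.2))
    (C := fun j => R (((e'.1 + (((z e'.2 : ℕ) + j) / L) • (Pi.single e'.2 (1 : ZMod M)),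
      update z e'.2 ⟨((z e'.2 : ℕ) + j) % L, Nat.mod_lt _ hL⟩) : (Fin d → ZMod M) × (Fin d → Fin L)), μ))
    (T := T e' (e'.1, z)) (T' := T e' (e'.1, update z μ ⟨(z μ : ℕ) + 1, h⟩))
    (W := W e'.1 (e'.1, z)) (W' := W (e'.1 + Pi.single e'.2 1) (e'.1 + Pi.single e'.2 1, z))
    (Wa := W e'.1 (e'.1, update z μ ⟨(z μ : ℕ) + 1, h⟩))
    (Wb := W (e'.1 + Pi.single e'.2 1) (e'.1 + Pi.single e'.2 1, update z μ ⟨(z μ : ℕ) + 1, h⟩))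
    ?_ ?_ ?_ ?_ ?_ ?_ ?_ ?_ ?_ ?_ ?_ hphat ?_ w
  -- (the twelve letters are supplied one by one: a one-shot application makes the elaborator's unifier diverge)
  · exact fun i => hR _
  · exact fun i => hR _
  · exact fun j => hR _
  · exact hT0 e' (e'.1, z)
  · exact hTA
  · exact hT0 e' _
  · exact hTB
  · exact hW _ _
  · exact hW _ _
  · exact hWx
  · exact hWx'
  · exact hpl

end Step

/-! ## §3 The closed-loop letter on every block and the polar links of the lattice field -/

section Lattice

variable {o : Type*} [Fintype o] [DecidableEq o]

/-- **`loopDefect_lattice` — PART 57 ∕ 58's CLOSED-LOOP LETTER ON THE BLOCK** [our proof; §2 + PART 59 `loopDefect_comb`].  Same data as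
`canonicalStep_loopDefect`.  For every coarse bond `e′ = (y, μ′)` and all positions `z, z′` of the block `y`:
`|(τ_{(y,z)}ᵀ·τ_{(y,z′)} − 1)w|² ≤ (2d(L−1)·L·p̂)²·|w|²`, `τ_x = W(y,x)·T(e′,x,L)·W(y + e_{μ′}, (x.1 + e_{μ′}, x.2))ᵀ`. -/
theorem loopDefect_lattice [NeZero M] (hL : 0 < L)
    {R : ((Fin d → ZMod M) × (Fin d → Fin L)) × Fin d → Matrix o o ℝ} (hR : ∀ e, (R e)ᵀ * R e = 1) {phat : ℝ} (hphat : 0 ≤ phat)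
    (hplaq : ∀ (p : (Fin d → ZMod M) × (Fin d → Fin L)) (μ' μ : Fin d), μ' ≠ μ → ∀ w : o → ℝ,
      ((R (p, μ') *
              R (((p.1 + (((p.2 μ' : ℕ) + 1) / L) • (Pi.single μ' (1 : ZMod M)), update p.2 μ' ⟨((p.2 μ' : ℕ) + 1) % L, Nat.mod_lt _ hL⟩) :
                (Fin d → ZMod M) × (Fin d → Fin L)), μ) *
            (R (((p.1 + (((p.2 μ : ℕ) + 1) / L) • (Pi.single μ (1 : ZMod M)), update p.2 μ ⟨((p.2 μ : ℕ) + 1) % L, Nat.mod_lt _ hL⟩) :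
                (Fin d → ZMod M) × (Fin d → Fin L)), μ'))ᵀ *
          (R (p, μ))ᵀ - 1) *ᵥ w) ⬝ᵥ
        ((R (p, μ') *
              R (((p.1 + (((p.2 μ' : ℕ) + 1) / L) • (Pi.single μ' (1 : ZMod M)), update p.2 μ' ⟨((p.2 μ' : ℕ) + 1) % L, Nat.mod_lt _ hL⟩) :
                (Fin d → ZMod M) × (Fin d → Fin L)), μ) *
            (R (((p.1 + (((p.2 μ : ℕ) + 1) / L) • (Pi.single μ (1 : ZMod M)), update p.2 μ ⟨((p.2 μ : ℕ) + 1) % L, Nat.mod_lt _ hL⟩) :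
                (Fin d → ZMod M) × (Fin d → Fin L)), μ'))ᵀ *
          (R (p, μ))ᵀ - 1) *ᵥ w) ≤ phat ^ 2 * (w ⬝ᵥ w))
    {W : (Fin d → ZMod M) → (Fin d → ZMod M) × (Fin d → Fin L) → Matrix o o ℝ} (hW : ∀ y x, (W y x)ᵀ * W y x = 1)
    (hWstep : ∀ (y : Fin d → ZMod M) (z : Fin d → Fin L) (μ : Fin d) (h : (z μ : ℕ) + 1 < L), (∀ ν, μ < ν → (z ν : ℕ) = 0) →
      W y (y, update z μ ⟨(z μ : ℕ) + 1, h⟩) = W y (y, z) * R ((y, z), μ))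
    {T : (Fin d → ZMod M) × Fin d → (Fin d → ZMod M) × (Fin d → Fin L) → ℕ → Matrix o o ℝ} (hT0 : ∀ e' x, T e' x 0 = 1)
    (hT : ∀ e' x i, i < L → T e' x (i + 1) = T e' x i *
      R (((x.1 + (((x.2 e'.2 : ℕ) + i) / L) • (Pi.single e'.2 (1 : ZMod M)),
            update x.2 e'.2 ⟨((x.2 e'.2 : ℕ) + i) % L, Nat.mod_lt _ hL⟩) : (Fin d → ZMod M) × (Fin d → Fin L)), e'.2))
    (e' : (Fin d → ZMod M) × Fin d) (z z' : Fin d → Fin L) (w : o → ℝ) :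
    (((W e'.1 (e'.1, z) * T e' (e'.1, z) L * (W (e'.1 + Pi.single e'.2 1) (e'.1 + Pi.single e'.2 1, z))ᵀ)ᵀ *
            (W e'.1 (e'.1, z') * T e' (e'.1, z') L * (W (e'.1 + Pi.single e'.2 1) (e'.1 + Pi.single e'.2 1, z'))ᵀ) - 1) *ᵥ w) ⬝ᵥ
        (((W e'.1 (e'.1, z) * T e' (e'.1, z) L * (W (e'.1 + Pi.single e'.2 1) (e'.1 + Pi.single e'.2 1, z))ᵀ)ᵀ *
            (W e'.1 (e'.1, z') * T e' (e'.1, z') L * (W (e'.1 + Pi.single e'.2 1) (e'.1 + Pi.single e'.2 1, z'))ᵀ) - 1) *ᵥ w) ≤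
      (2 * (d * ((L : ℝ) - 1)) * (L * phat)) ^ 2 * (w ⬝ᵥ w) := by
  -- the open transports are orthogonal
  have hTo : ∀ x, (T e' x L)ᵀ * T e' x L = 1 := fun x =>
    orthogonal_partialTransport (R := fun i => R (((x.1 + (((x.2 e'.2 : ℕ) + i) / L) • (Pi.single e'.2 (1 : ZMod M)),
      update x.2 e'.2 ⟨((x.2 e'.2 : ℕ) + i) % L, Nat.mod_lt _ hL⟩) : (Fin d → ZMod M) × (Fin d → Fin L)), e'.2))
      (fun i _ => hR _) (hT0 e' x) (fun i hi => hT e' x i hi) L le_rfl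
  have hτ : ∀ z : Fin d → Fin L,
      (W e'.1 (e'.1, z) * T e' (e'.1, z) L * (W (e'.1 + Pi.single e'.2 1) (e'.1 + Pi.single e'.2 1, z))ᵀ)ᵀ *
        (W e'.1 (e'.1, z) * T e' (e'.1, z) L * (W (e'.1 + Pi.single e'.2 1) (e'.1 + Pi.single e'.2 1, z))ᵀ) = 1 := fun z =>
    orthogonal_mul (orthogonal_mul (hW _ _) (hTo _)) (transpose_orthogonal (hW _ _))
  exact loopDefect_comb hL
    (τ := fun z : Fin d → Fin L => W e'.1 (e'.1, z) * T e' (e'.1, z) L * (W (e'.1 + Pi.single e'.2 1) (e'.1 + Pi.single e'.2 1, z))ᵀ)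
    hτ (mul_nonneg (Nat.cast_nonneg L) hphat)
    (fun z μ h hlater w => canonicalStep_loopDefect hL hR hphat hplaq hW hWstep hT0 hT e' z μ h hlater w) z z' w

/-- **`exists_polarLink_lattice` — THE POLAR LINKS OF THE COMB-AVERAGED LATTICE FIELD EXIST** [our proof; `loopDefect_lattice` + PART 58
`exists_polarLink`].  Same data; if `2d(L−1)·L·p̂ < 1` then there are ORTHOGONAL coarse links `R′ (y, μ′)` such that, with
`N (y,μ′) x = 1 − W(y,x)·T_L(x)·W(y + e_{μ′}, (x.1 + e_{μ′}, x.2))ᵀ·R′ᵀ`, the block mean `Σ_x [x.1 = y](L^d)⁻¹•N (y,μ′) x` is SYMMETRIC (PART 53 ∕ 54's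
`hsym`) and the block mean of the transports `Σ_x [x.1 = y](L^d)⁻¹•(W T W′ᵀR′ᵀ)` is POSITIVE SEMIDEFINITE (PART 57's `hPpsd`). -/
theorem exists_polarLink_lattice [NeZero M] (hL : 0 < L)
    {R : ((Fin d → ZMod M) × (Fin d → Fin L)) × Fin d → Matrix o o ℝ} (hR : ∀ e, (R e)ᵀ * R e = 1) {phat : ℝ} (hphat : 0 ≤ phat)
    (hplaq : ∀ (p : (Fin d → ZMod M) × (Fin d → Fin L)) (μ' μ : Fin d), μ' ≠ μ → ∀ w : o → ℝ,
      ((R (p, μ') *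
              R (((p.1 + (((p.2 μ' : ℕ) + 1) / L) • (Pi.single μ' (1 : ZMod M)), update p.2 μ' ⟨((p.2 μ' : ℕ) + 1) % L, Nat.mod_lt _ hL⟩) :
                (Fin d → ZMod M) × (Fin d → Fin L)), μ) *
            (R (((p.1 + (((p.2 μ : ℕ) + 1) / L) • (Pi.single μ (1 : ZMod M)), update p.2 μ ⟨((p.2 μ : ℕ) + 1) % L, Nat.mod_lt _ hL⟩) :
                (Fin d → ZMod M) × (Fin d → Fin L)), μ'))ᵀ *
          (R (p, μ))ᵀ - 1) *ᵥ w) ⬝ᵥ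
        ((R (p, μ') *
              R (((p.1 + (((p.2 μ' : ℕ) + 1) / L) • (Pi.single μ' (1 : ZMod M)), update p.2 μ' ⟨((p.2 μ' : ℕ) + 1) % L, Nat.mod_lt _ hL⟩) :
                (Fin d → ZMod M) × (Fin d → Fin L)), μ) *
            (R (((p.1 + (((p.2 μ : ℕ) + 1) / L) • (Pi.single μ (1 : ZMod M)), update p.2 μ ⟨((p.2 μ : ℕ) + 1) % L, Nat.mod_lt _ hL⟩) :
                (Fin d → ZMod M) × (Fin d → Fin L)), μ'))ᵀ *
          (R (p, μ))ᵀ - 1) *ᵥ w) ≤ phat ^ 2 * (w ⬝ᵥ w))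
    {W : (Fin d → ZMod M) → (Fin d → ZMod M) × (Fin d → Fin L) → Matrix o o ℝ} (hW : ∀ y x, (W y x)ᵀ * W y x = 1)
    (hWstep : ∀ (y : Fin d → ZMod M) (z : Fin d → Fin L) (μ : Fin d) (h : (z μ : ℕ) + 1 < L), (∀ ν, μ < ν → (z ν : ℕ) = 0) →
      W y (y, update z μ ⟨(z μ : ℕ) + 1, h⟩) = W y (y, z) * R ((y, z), μ))
    {T : (Fin d → ZMod M) × Fin d → (Fin d → ZMod M) × (Fin d → Fin L) → ℕ → Matrix o o ℝ} (hT0 : ∀ e' x, T e' x 0 = 1)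
    (hT : ∀ e' x i, i < L → T e' x (i + 1) = T e' x i *
      R (((x.1 + (((x.2 e'.2 : ℕ) + i) / L) • (Pi.single e'.2 (1 : ZMod M)),
            update x.2 e'.2 ⟨((x.2 e'.2 : ℕ) + i) % L, Nat.mod_lt _ hL⟩) : (Fin d → ZMod M) × (Fin d → Fin L)), e'.2))
    (hsmall : 2 * (d * ((L : ℝ) - 1)) * (L * phat) < 1) :
    ∃ R' : (Fin d → ZMod M) × Fin d → Matrix o o ℝ, (∀ e', (R' e')ᵀ * R' e' = 1) ∧
      (∀ e', (∑ x : (Fin d → ZMod M) × (Fin d → Fin L), (if x.1 = e'.1 then ((L : ℝ) ^ d)⁻¹ else 0) •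
          (1 - W e'.1 x * T e' x L * (W (e'.1 + Pi.single e'.2 1) (x.1 + Pi.single e'.2 1, x.2))ᵀ * (R' e')ᵀ))ᵀ =
        ∑ x : (Fin d → ZMod M) × (Fin d → Fin L), (if x.1 = e'.1 then ((L : ℝ) ^ d)⁻¹ else 0) •
          (1 - W e'.1 x * T e' x L * (W (e'.1 + Pi.single e'.2 1) (x.1 + Pi.single e'.2 1, x.2))ᵀ * (R' e')ᵀ)) ∧
      (∀ e' (w : o → ℝ), 0 ≤ w ⬝ᵥ ((∑ x : (Fin d → ZMod M) × (Fin d → Fin L), (if x.1 = e'.1 then ((L : ℝ) ^ d)⁻¹ else 0) •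
          (W e'.1 x * T e' x L * (W (e'.1 + Pi.single e'.2 1) (x.1 + Pi.single e'.2 1, x.2))ᵀ * (R' e')ᵀ)) *ᵥ w)) := by
  haveI : NeZero L := ⟨hL.ne'⟩
  have hD0 : 0 ≤ 2 * (d * ((L : ℝ) - 1)) * (L * phat) := by
    have hL1 : (1 : ℝ) ≤ L := by exact_mod_cast hL
    have : 0 ≤ (L : ℝ) - 1 := by linarith
    positivity
  -- positive weight means `x.1 = y`
  have hblock : ∀ (y : Fin d → ZMod M) (x : (Fin d → ZMod M) × (Fin d → Fin L)),
      (if x.1 = y then ((L : ℝ) ^ d)⁻¹ else 0) ≠ 0 → x.1 = y := fun y x hx => by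
    by_contra h
    exact hx (if_neg h)
  -- the local loop letter, in the letters of PART 58 (`σ e′ = (· + e_{μ′}) × id`)
  have hloc : ∀ (e' : (Fin d → ZMod M) × Fin d) (x x' : (Fin d → ZMod M) × (Fin d → Fin L)),
      (if x.1 = e'.1 then ((L : ℝ) ^ d)⁻¹ else 0) ≠ 0 → (if x'.1 = e'.1 then ((L : ℝ) ^ d)⁻¹ else 0) ≠ 0 → ∀ w : o → ℝ,
      (((W e'.1 x * T e' x L *
              (W (e'.1 + Pi.single e'.2 1) (((Equiv.addRight (Pi.single e'.2 (1 : ZMod M))).prodCongr (Equiv.refl (Fin d → Fin L))) x))ᵀ)ᵀ *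
            (W e'.1 x' * T e' x' L *
              (W (e'.1 + Pi.single e'.2 1) (((Equiv.addRight (Pi.single e'.2 (1 : ZMod M))).prodCongr (Equiv.refl (Fin d → Fin L))) x'))ᵀ) -
            1) *ᵥ w) ⬝ᵥ
        (((W e'.1 x * T e' x L *
              (W (e'.1 + Pi.single e'.2 1) (((Equiv.addRight (Pi.single e'.2 (1 : ZMod M))).prodCongr (Equiv.refl (Fin d → Fin L))) x))ᵀ)ᵀ *
            (W e'.1 x' * T e' x' L *
              (W (e'.1 + Pi.single e'.2 1) (((Equiv.addRight (Pi.single e'.2 (1 : ZMod M))).prodCongr (Equiv.refl (Fin d → Fin L))) x'))ᵀ) -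
            1) *ᵥ w) ≤ (2 * (d * ((L : ℝ) - 1)) * (L * phat)) ^ 2 * (w ⬝ᵥ w) := by
    intro e' x x' hx hx' w
    obtain ⟨x1, x2⟩ := x
    obtain ⟨x1', x2'⟩ := x'
    have h1 : x1 = e'.1 := hblock e'.1 (x1, x2) hx
    have h1' : x1' = e'.1 := hblock e'.1 (x1', x2') hx'
    subst h1 h1'
    exact loopDefect_lattice hL hR hphat hplaq hW hWstep hT0 hT e' x2 x2' w
  obtain ⟨R', h1, h2, h3⟩ := exists_polarLink (o := o) (μ := Fin d → ZMod M) (ν := (Fin d → ZMod M) × (Fin d → Fin L))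
    (β' := (Fin d → ZMod M) × Fin d)
    (q := fun (y : Fin d → ZMod M) (x : (Fin d → ZMod M) × (Fin d → Fin L)) => if x.1 = y then ((L : ℝ) ^ d)⁻¹ else 0)
    (W := W) (src' := fun e' : (Fin d → ZMod M) × Fin d => e'.1)
    (tgt' := fun e' : (Fin d → ZMod M) × Fin d => e'.1 + Pi.single e'.2 1)
    (σ := fun e' : (Fin d → ZMod M) × Fin d => (Equiv.addRight (Pi.single e'.2 (1 : ZMod M))).prodCongr (Equiv.refl (Fin d → Fin L)))
    (ℓ := L) (T := T) (D := 2 * (d * ((L : ℝ) - 1)) * (L * phat))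
    (fun y x => blockWeight_nonneg y x) (fun y => sum_blockWeight y) hloc hD0 hsmall
  refine ⟨R', h1, fun e' => ?_, fun e' w => ?_⟩
  · exact h2 e'
  · exact h3 e' w

end Lattice

end Summit.QuantumFields.BalabanUV.Beta.GAN24.DerivativeRateTransferJensenMassFreeRectangle

end
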